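import Summits.RiemannHypothesis.RiemannHypothesis.Theorems.JensenLogBandArcModel
import HarnessLib

/-!
# Route JensenLogBand, BAND crux (stmt-RiemannHypothesis-19913) — infrastructure (S4)(0):
# the descent identity `d/dφ log ‖model integrand‖ = Re( i(u−c) · S_{n,c}(u) )` (RH-FREE)

Cell rh-jensen, LADDER-RH rung J-P(P3) «log band»; the BAND lead's LINE-PLAN step (S4) (phase
geometry on the circle `u = c + h e^{iφ}`) starts from the φ-derivative of the logarithm of the
`ζ`-free integrand `arcModelIntegrand n h c φ = i(u−c)·γ̃(½+u)·K_{n,c}(u)` (lead's p484671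
`JensenLogBandArcModel`). This file proves the identity announced there:

* `hasDerivAt_log_norm` — generic: for `f : ℝ → ℂ` with `HasDerivAt f f′ x`, `f x ≠ 0`:
  `d/dt log ‖f t‖ = Re (f′ / f x)`;
* `hasDerivAt_sqKernel_point` — `d/du K_{n,c}(u) = 2D⁻¹(1 − 2(n+1)u²/(u²−c²))`, `D = (u²−c²)^{n+1}`;
* `hasDerivAt_arcModelIntegrand_angle` — `d/dφ (model integrand) = (model integrand)·(i(u−c)·S_{n,c}(u))`
  with the lead's saddle function `S_{n,c} = arcSaddleFn n c` (`= γ̃′/γ̃(½+u) + 1/u − n/(u−c) − (n+1)/(u+c)`);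
* `hasDerivAt_log_norm_arcModelIntegrand` — hence `d/dφ log ‖arcModelIntegrand n h c φ‖ =
  Re (i(u−c)·S_{n,c}(u))`: the saddle of the φ-density is exactly a zero of `S_{n,c}`, and the global
  descent (S4)(i) is the integral of this derivative.

Hypotheses at the point: `h ≠ 0`, `Re(½+u) > 0`, `½+u ≠ 1`, `u ≠ 0`, `u + c ≠ 0` (`u − c = h e^{iφ} ≠ 0`).
WHAT THIS IS NOT: calculus on an explicit integrand; nothing here bears on zeros of `ζ` or the truth
of RH. (prover-rh-jensen-eng-2-g5-0, 2026-08-27.)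
-/

noncomputable section

open Complex Metric Set

set_option linter.dupNamespace false

namespace Summit.RiemannHypothesis.RiemannHypothesis.Theorems.JensenPolynomials.LogBandArc

open Literature.NumberTheory.LFunctions

/-! ## `d/dt log ‖f t‖ = Re (f′/f)` -/

/-- **Logarithmic derivative of the modulus:** for `f : ℝ → ℂ` with `HasDerivAt f f′ x` and
`f x ≠ 0`, `t ↦ log ‖f t‖` has derivative `Re (f′ / f x)` at `x`. RH-FREE. -/
theorem hasDerivAt_log_norm {f : ℝ → ℂ} {f' : ℂ} {x : ℝ} (hf : HasDerivAt f f' x)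
    (hx : f x ≠ 0) : HasDerivAt (fun t : ℝ => Real.log ‖f t‖) ((f' / f x).re) x := by
  have hre : HasDerivAt (fun t : ℝ => (f t).re) f'.re x :=
    Complex.reCLM.hasFDerivAt.comp_hasDerivAt x hf
  have him : HasDerivAt (fun t : ℝ => (f t).im) f'.im x :=
    Complex.imCLM.hasFDerivAt.comp_hasDerivAt x hf
  -- `‖f t‖² = re² + im²`
  have hsq : HasDerivAt (fun t : ℝ => ‖f t‖ ^ 2)
      (2 * (f x).re * f'.re + 2 * (f x).im * f'.im) x := by
    have h := (hre.fun_pow 2).add (him.fun_pow 2)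
    have e : (fun t : ℝ => ‖f t‖ ^ 2) = fun t : ℝ => (f t).re ^ 2 + (f t).im ^ 2 := by
      funext t; rw [Complex.sq_norm, Complex.normSq_apply]; ring
    rw [e]
    refine h.congr_deriv ?_
    simp only [Nat.cast_ofNat]
    ring
  have hnx : ‖f x‖ ≠ 0 := norm_ne_zero_iff.2 hx
  have hsq0 : ‖f x‖ ^ 2 ≠ 0 := pow_ne_zero 2 hnx
  have hlog := (hsq.log hsq0).const_mul (1 / 2 : ℝ)
  have e2 : (fun t : ℝ => Real.log ‖f t‖) = fun t : ℝ => 1 / 2 * Real.log (‖f t‖ ^ 2) := by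
    funext t
    rw [Real.log_pow]
    ring
  rw [e2]
  refine hlog.congr_deriv ?_
  rw [Complex.div_re]
  have hn : Complex.normSq (f x) = ‖f x‖ ^ 2 := (Complex.sq_norm _).symm
  rw [hn]
  field_simp

/-! ## The `u`-derivative of the kernel at a point -/

/-- `d/du K_{n,c}(u) = 2·((u²−c²)^{n+1})⁻¹·(1 − 2(n+1)·u²/(u²−c²))` for `u² ≠ c²`. RH-FREE. -/
theorem hasDerivAt_sqKernel_point (n : ℕ) (c : ℂ) {u : ℂ} (hD : u ^ 2 - c ^ 2 ≠ 0) :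
    HasDerivAt (fun w : ℂ => sqKernel n c w)
      (2 * ((u ^ 2 - c ^ 2) ^ (n + 1))⁻¹ * (1 - 2 * ((n : ℂ) + 1) * u ^ 2 / (u ^ 2 - c ^ 2))) u := by
  have hDn : (u ^ 2 - c ^ 2) ^ (n + 1) ≠ 0 := pow_ne_zero _ hD
  have hpoly : HasDerivAt (fun w : ℂ => (w ^ 2 - c ^ 2) ^ (n + 1))
      (((n + 1 : ℕ) : ℂ) * (u ^ 2 - c ^ 2) ^ n * (2 * u)) u := by
    have h1 : HasDerivAt (fun w : ℂ => w ^ 2 - c ^ 2) (2 * u) u := by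
      simpa using ((hasDerivAt_id' u).fun_pow 2).sub_const (c ^ 2)
    simpa using h1.fun_pow (n + 1)
  have hinv := hpoly.inv hDn
  have hlin : HasDerivAt (fun w : ℂ => 2 * w) 2 u := by
    simpa using (hasDerivAt_id' u).const_mul (2 : ℂ)
  have hprod := hlin.mul hinv
  have e : (fun w : ℂ => sqKernel n c w) = fun w : ℂ => 2 * w * ((w ^ 2 - c ^ 2) ^ (n + 1))⁻¹ := by
    funext w; rw [sqKernel]
  rw [e]
  refine hprod.congr_deriv ?_
  simp only [Pi.inv_apply]
  push_cast
  field_simp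
  ring

/-! ## The φ-derivative of the model integrand -/

/-- **`d/dφ (model integrand) = (model integrand) · (i(u−c) · S_{n,c}(u))`** on the circle
`u = c + h e^{iφ}`, at a point with `Re(½+u) > 0`, `½+u ≠ 1`, `u ≠ 0`, `u + c ≠ 0`, `h ≠ 0`.
RH-FREE. -/
theorem hasDerivAt_arcModelIntegrand_angle (n : ℕ) {h : ℝ} (hh : h ≠ 0) (c : ℂ) (φ : ℝ)
    (hre : 0 < (1 / 2 + circleMap c h φ).re) (h1 : 1 / 2 + circleMap c h φ ≠ 1)
    (hu0 : circleMap c h φ ≠ 0) (hupc : circleMap c h φ + c ≠ 0) :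
    HasDerivAt (fun θ : ℝ => arcModelIntegrand n h c θ)
      (arcModelIntegrand n h c φ *
        (I * (circleMap c h φ - c) * arcSaddleFn n c (circleMap c h φ))) φ := by
  set u : ℂ := circleMap c h φ with hu
  have huc : u - c ≠ 0 := by
    rw [hu]; exact sub_ne_zero.2 (circleMap_ne_center hh)
  have hD : u ^ 2 - c ^ 2 ≠ 0 := by
    have : u ^ 2 - c ^ 2 = (u - c) * (u + c) := by ring
    rw [this]; exact mul_ne_zero huc hupc
  have hDn : (u ^ 2 - c ^ 2) ^ (n + 1) ≠ 0 := pow_ne_zero _ hD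
  set G : ℂ := xiGammaFactor (1 / 2 + u) with hG
  set L : ℂ := logDeriv xiGammaFactor (1 / 2 + u) with hL
  have hG0 : G ≠ 0 := xiGammaFactor_ne_zero hre h1
  -- the circle map and its derivative `u′ = i(u − c)`
  have hcm : HasDerivAt (circleMap c h) (I * (u - c)) φ := by
    have h0 := hasDerivAt_circleMap c h φ
    rw [← deriv_circleMap, deriv_circleMap_eq_I_mul_sub] at h0
    exact h0
  -- (1) the Jacobian factor `φ ↦ deriv (circleMap c h) φ = i(u(φ) − c)`
  have hd1 : HasDerivAt (fun θ : ℝ => deriv (circleMap c h) θ) (I * (I * (u - c))) φ := by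
    have e : (fun θ : ℝ => deriv (circleMap c h) θ) = fun θ : ℝ => I * (circleMap c h θ - c) :=
      funext fun θ => deriv_circleMap_eq_I_mul_sub c h θ
    rw [e]
    simpa using (hcm.sub_const c).const_mul I
  -- (2) the Γ-factor `φ ↦ γ̃(½ + u(φ))`, derivative `γ̃′(½+u)·u′ = L·G·u′`
  have hderivG : deriv xiGammaFactor (1 / 2 + u) = L * G := by
    have h0 := div_mul_cancel₀ (deriv xiGammaFactor (1 / 2 + u)) hG0
    rw [hL, logDeriv_apply]
    exact h0.symm
  have hd2 : HasDerivAt (fun θ : ℝ => xiGammaFactor (1 / 2 + circleMap c h θ))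
      (L * G * (I * (u - c))) φ := by
    have hin : HasDerivAt (fun θ : ℝ => 1 / 2 + circleMap c h θ) (I * (u - c)) φ := by
      simpa using hcm.const_add (1 / 2 : ℂ)
    have hout : HasDerivAt xiGammaFactor (deriv xiGammaFactor (1 / 2 + u)) (1 / 2 + u) :=
      (differentiableAt_xiGammaFactor hre).hasDerivAt
    have h := hout.comp φ hin
    rw [hderivG] at h
    exact h
  -- (3) the kernel `φ ↦ K_{n,c}(u(φ))`
  have hK := hasDerivAt_sqKernel_point n c hD
  have hd3 : HasDerivAt (fun θ : ℝ => sqKernel n c (circleMap c h θ))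
      (2 * ((u ^ 2 - c ^ 2) ^ (n + 1))⁻¹ * (1 - 2 * ((n : ℂ) + 1) * u ^ 2 / (u ^ 2 - c ^ 2)) *
        (I * (u - c))) φ := by
    have h3 := hK.comp φ hcm
    simpa [Function.comp_def] using h3
  -- assemble
  have hprod := hd1.mul (hd2.mul hd3)
  have efun : (fun θ : ℝ => arcModelIntegrand n h c θ) =
      fun θ : ℝ => deriv (circleMap c h) θ *
        (xiGammaFactor (1 / 2 + circleMap c h θ) * sqKernel n c (circleMap c h θ)) := by
    funext θ; rw [arcModelIntegrand]
  rw [efun]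
  refine hprod.congr_deriv ?_
  -- the algebra: everything in terms of `u`, `G`, `L`
  have hval : deriv (circleMap c h) φ = I * (u - c) := deriv_circleMap_eq_I_mul_sub c h φ
  simp only [Pi.mul_apply]
  rw [arcModelIntegrand, arcSaddleFn]
  simp only [hval, sqKernel, ← hu, ← hG, ← hL]
  field_simp
  ring

/-- **The descent identity (S4)(0):** `d/dφ log ‖arcModelIntegrand n h c φ‖ = Re( i(u−c)·S_{n,c}(u) )`
at every angle where `Re(½+u) > 0`, `½+u ≠ 1`, `u ≠ 0`, `u + c ≠ 0` (`h ≠ 0`). Hence the saddle of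
the φ-density (critical point of its modulus along the arc) is a zero of `Re(i(u−c)S_{n,c}(u))`,
and the global descent of (S4)(i) is `log‖I(φ)‖ − log‖I(φ₀)‖ = ∫_{φ₀}^{φ} Re(i(u−c)S_{n,c}(u)) dθ`.
RH-FREE. -/
theorem hasDerivAt_log_norm_arcModelIntegrand (n : ℕ) {h : ℝ} (hh : h ≠ 0) (c : ℂ) (φ : ℝ)
    (hre : 0 < (1 / 2 + circleMap c h φ).re) (h1 : 1 / 2 + circleMap c h φ ≠ 1)
    (hu0 : circleMap c h φ ≠ 0) (hupc : circleMap c h φ + c ≠ 0) :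
    HasDerivAt (fun θ : ℝ => Real.log ‖arcModelIntegrand n h c θ‖)
      ((I * (circleMap c h φ - c) * arcSaddleFn n c (circleMap c h φ)).re) φ := by
  have hd := hasDerivAt_arcModelIntegrand_angle n hh c φ hre h1 hu0 hupc
  -- the model integrand does not vanish at `φ`
  have huc : circleMap c h φ - c ≠ 0 := sub_ne_zero.2 (circleMap_ne_center hh)
  have hD : (circleMap c h φ) ^ 2 - c ^ 2 ≠ 0 := by
    have : (circleMap c h φ) ^ 2 - c ^ 2 = (circleMap c h φ - c) * (circleMap c h φ + c) := by ring
    rw [this]; exact mul_ne_zero huc hupc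
  have hM : arcModelIntegrand n h c φ ≠ 0 := by
    rw [arcModelIntegrand, deriv_circleMap_eq_I_mul_sub, sqKernel]
    refine mul_ne_zero (mul_ne_zero Complex.I_ne_zero huc) (mul_ne_zero (xiGammaFactor_ne_zero hre h1) ?_)
    exact mul_ne_zero (mul_ne_zero two_ne_zero hu0) (inv_ne_zero (pow_ne_zero _ hD))
  have h := hasDerivAt_log_norm hd hM
  refine h.congr_deriv ?_
  rw [mul_div_cancel_left₀ _ hM]

end Summit.RiemannHypothesis.RiemannHypothesis.Theorems.JensenPolynomials.LogBandArc
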